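import Literature.NumberTheory.LFunctions.ConreyIwaniec2002KernelMellin
import Literature.NumberTheory.LFunctions.ConreyIwaniec2002Thm61OffDiagSeries
import Mathlib.Analysis.Calculus.ContDiff.Bounds
import Mathlib.Tactic.IntervalCases
import HarnessLib

/-!
# Conrey–Iwaniec (2002), Theorem 6.1: the constituents of (6.27) are admissible test functions for (6.19)

B. Conrey, H. Iwaniec, Acta Arith. 103 (2002), §6, proof of (6.27) [held text `paper:arxiv-math_0111012`,
p0015:L52–63]: "By (6.19) we derive `S*(h) = σ(h)∫a(y+h)ā(y)L(hT/y)dy + O(…)` (6.27). Well, not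
immediately because `a(y)` is not supported in a dyadic segment. However, using a smooth partition of
unity with constituents … one can justify the applicability of (6.19)".

The applicability of (6.19) (`ShiftedConvolutionBound`, test functions `IsBumpOn X g`: `C²`,
supported in `[X, 2X]`, `x^ν|g^{(ν)}| ≤ 1`) to the constituents requires:

* a Leibniz bound on `(0,∞)` for `ν ≤ 2` (`leibniz_Ioi`): if `‖f‖, x‖f′‖, x²‖f″‖ ≤ A` and the same
  for `g` with `B` at a point `x > 0`, then `‖fg‖ ≤ AB`, `x‖(fg)′‖ ≤ 2AB`, `x²‖(fg)″‖ ≤ 4AB`;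
* `ā` has the same bounds as `a` (`norm_iteratedDeriv_conj`);
* `ℓ(x) = L(c/x)` (`c = hT`) satisfies `|ℓ| ≤ 1`, `x|ℓ′| ≤ 1`, `x²|ℓ″| ≤ 3` on `x > 0`, from
  `|L^{(j)}(v)| ≤ (1+|v|)⁻⁴` (6.3) ("`x|∂ₓL(hT/x)| ≤ sup v|L′(v)| ≤ 1`" of the line card);
* the generic constituent `φ·b/(4PW)` is `IsBumpOn X` when `φ ∈ C²(ℝ)` is real, vanishes off
  `[X, 2X]` and has `|x|^m|φ^{(m)}| ≤ P`, while `b ∈ C²(0,∞)` has `‖b‖, x‖b′‖, x²‖b″‖ ≤ W` on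
  `[X, 2X]` (`isBumpOn_of_bounds`);
* (6.19) for un-normalised constituents `Φ_j = M_j g_j`: the bound scales by `M₁M₂`
  (`shifted_bound_scaled`).

PROVED HERE (namespace `ConreyIwaniec2002.Thm61Bumps`), no `sorry`, no `def`. Toolkit for the
registered stub S2b `stub_thm61_shifted` of SKELETON P64 (line `thm61-cm-convolution`).

## References
* [ConreyIwaniec2002] B. Conrey, H. Iwaniec, Acta Arith. 103 (2002) 259–312: §4 (4.23), §6 (6.3),
  (6.14), (6.18)–(6.19), (6.27).
-/

noncomputable section

open Set Filter MeasureTheory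
open scoped Topology

namespace Literature.NumberTheory.LFunctions

namespace ConreyIwaniec2002

namespace Thm61Bumps

/-! ### Leibniz on `(0,∞)` for `ν ≤ 2` -/

/-- On the open half-line the within-derivative is the derivative (norms).
[cite: ConreyIwaniec2002, §6 (6.14)] -/
theorem norm_iteratedFDerivWithin_Ioi {g : ℝ → ℂ} {x : ℝ} (hx : 0 < x) (i : ℕ) :
    ‖iteratedFDerivWithin ℝ i g (Ioi 0) x‖ = ‖iteratedDeriv i g x‖ := by
  rw [norm_iteratedFDerivWithin_eq_norm_iteratedDerivWithin, iteratedDerivWithin_of_isOpen isOpen_Ioi hx]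

/-- **Leibniz with the weights `1, x, x²`** at a point `x > 0` for `C²` functions on `(0,∞)`:
bounds `A` for `f` and `B` for `g` give `AB, 2AB, 4AB` for `fg`.
[cite: ConreyIwaniec2002, §6 (6.14), (6.18)] -/
theorem leibniz_Ioi {f g : ℝ → ℂ} (hf : ContDiffOn ℝ 2 f (Ioi 0)) (hg : ContDiffOn ℝ 2 g (Ioi 0))
    {x : ℝ} (hx : 0 < x) {A B : ℝ}
    (hf0 : ‖f x‖ ≤ A) (hf1 : x * ‖iteratedDeriv 1 f x‖ ≤ A) (hf2 : x ^ 2 * ‖iteratedDeriv 2 f x‖ ≤ A)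
    (hg0 : ‖g x‖ ≤ B) (hg1 : x * ‖iteratedDeriv 1 g x‖ ≤ B)
    (hg2 : x ^ 2 * ‖iteratedDeriv 2 g x‖ ≤ B) :
    ‖f x * g x‖ ≤ A * B ∧
      x * ‖iteratedDeriv 1 (fun y => f y * g y) x‖ ≤ 2 * (A * B) ∧
      x ^ 2 * ‖iteratedDeriv 2 (fun y => f y * g y) x‖ ≤ 4 * (A * B) := by
  have hA : 0 ≤ A := (norm_nonneg _).trans hf0
  have hL : ∀ n : ℕ, n ≤ 2 → ‖iteratedDeriv n (fun y => f y * g y) x‖ ≤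
      ∑ i ∈ Finset.range (n + 1),
        (n.choose i : ℝ) * ‖iteratedDeriv i f x‖ * ‖iteratedDeriv (n - i) g x‖ := by
    intro n hn
    have h := norm_iteratedFDerivWithin_mul_le (𝕜 := ℝ) (A := ℂ) (n := n) (N := 2) hf hg
      (uniqueDiffOn_Ioi 0) hx (by exact_mod_cast hn)
    simpa only [norm_iteratedFDerivWithin_Ioi hx] using h
  refine ⟨?_, ?_, ?_⟩
  · rw [norm_mul]; exact mul_le_mul hf0 hg0 (norm_nonneg _) hA
  · have h := hL 1 (by norm_num)
    simp only [Finset.sum_range_succ, Finset.sum_range_zero, zero_add, Nat.choose_zero_right,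
      Nat.choose_self, Nat.cast_one, one_mul, Nat.sub_zero, Nat.sub_self, iteratedDeriv_zero] at h
    calc x * ‖iteratedDeriv 1 (fun y => f y * g y) x‖
        ≤ x * (‖f x‖ * ‖iteratedDeriv 1 g x‖ + ‖iteratedDeriv 1 f x‖ * ‖g x‖) :=
          mul_le_mul_of_nonneg_left h hx.le
      _ = ‖f x‖ * (x * ‖iteratedDeriv 1 g x‖) + (x * ‖iteratedDeriv 1 f x‖) * ‖g x‖ := by ring
      _ ≤ A * B + A * B :=
          add_le_add (mul_le_mul hf0 hg1 (by positivity) hA)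
            (mul_le_mul hf1 hg0 (norm_nonneg _) hA)
      _ = 2 * (A * B) := by ring
  · have h := hL 2 le_rfl
    simp only [Finset.sum_range_succ, Finset.sum_range_zero, zero_add, Nat.choose_zero_right,
      Nat.choose_self, Nat.cast_one, one_mul, Nat.sub_zero, Nat.sub_self,
      show Nat.choose 2 1 = 2 by rfl, Nat.cast_ofNat, iteratedDeriv_zero,
      show (2:ℕ) - 1 = 1 by rfl] at h
    calc x ^ 2 * ‖iteratedDeriv 2 (fun y => f y * g y) x‖
        ≤ x ^ 2 * (‖f x‖ * ‖iteratedDeriv 2 g x‖ +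
            2 * ‖iteratedDeriv 1 f x‖ * ‖iteratedDeriv 1 g x‖ +
            ‖iteratedDeriv 2 f x‖ * ‖g x‖) := mul_le_mul_of_nonneg_left h (by positivity)
      _ = ‖f x‖ * (x ^ 2 * ‖iteratedDeriv 2 g x‖) +
            2 * ((x * ‖iteratedDeriv 1 f x‖) * (x * ‖iteratedDeriv 1 g x‖)) +
            (x ^ 2 * ‖iteratedDeriv 2 f x‖) * ‖g x‖ := by ring
      _ ≤ A * B + 2 * (A * B) + A * B := by
          refine add_le_add (add_le_add ?_ ?_) ?_
          · exact mul_le_mul hf0 hg2 (by positivity) hA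
          · exact mul_le_mul_of_nonneg_left (mul_le_mul hf1 hg1 (by positivity) hA) (by norm_num)
          · exact mul_le_mul hf2 hg0 (norm_nonneg _) hA
      _ = 4 * (A * B) := by ring

/-! ### Complex conjugation and real casts preserve the bounds -/

/-- `ā` is `C²` where `a` is. [cite: ConreyIwaniec2002, §6 (6.27)] -/
theorem contDiffOn_conj {a : ℝ → ℂ} {n : ℕ∞} {s : Set ℝ} (ha : ContDiffOn ℝ n a s) :
    ContDiffOn ℝ n (fun x => starRingEnd ℂ (a x)) s :=
  Complex.conjCLE.contDiff.comp_contDiffOn ha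

/-- `‖ā^{(i)}(x)‖ = ‖a^{(i)}(x)‖` on `x > 0`. [cite: ConreyIwaniec2002, §6 (6.27)] -/
theorem norm_iteratedDeriv_conj (a : ℝ → ℂ) {x : ℝ} (hx : 0 < x) (i : ℕ) :
    ‖iteratedDeriv i (fun y => starRingEnd ℂ (a y)) x‖ = ‖iteratedDeriv i a x‖ := by
  rw [← norm_iteratedFDerivWithin_Ioi hx, ← norm_iteratedFDerivWithin_Ioi hx]
  have h := Complex.conjLIE.norm_iteratedFDerivWithin_comp_left a (uniqueDiffOn_Ioi 0) hx i
  have e : (⇑Complex.conjLIE ∘ a) = fun y => starRingEnd ℂ (a y) :=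
    funext fun y => by simp [Complex.conjLIE_apply]
  rwa [e] at h

/-- `‖(φ : ℂ)^{(i)}(x)‖ = |φ^{(i)}(x)|` for a real `C²` function and `i ≤ 2`.
[cite: ConreyIwaniec2002, §6 (6.27)] -/
theorem norm_iteratedDeriv_ofReal {φ : ℝ → ℝ} (hφ : ContDiff ℝ 2 φ) {i : ℕ} (hi : i ≤ 2) (x : ℝ) :
    ‖iteratedDeriv i (fun y => (φ y : ℂ)) x‖ = |iteratedDeriv i φ x| := by
  have h := Complex.ofRealLI.norm_iteratedFDeriv_comp_left (f := φ) (x := x)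
    (hφ.contDiffAt) (i := i) (by exact_mod_cast hi)
  rw [norm_iteratedFDeriv_eq_norm_iteratedDeriv, norm_iteratedFDeriv_eq_norm_iteratedDeriv,
    Real.norm_eq_abs] at h
  have e : (⇑Complex.ofRealLI ∘ φ) = fun y => (φ y : ℂ) := funext fun y => rfl
  rwa [e] at h

/-! ### The factor `ℓ(x) = L(c/x)` -/

section Ell

variable {K : ℝ → ℝ} (hK : IsCIKernel K) {c : ℝ}
include hK

omit hK in
/-- `(c/x)' = -c/x²` at `x ≠ 0`. [folklore] -/
private theorem hasDerivAt_const_div {x : ℝ} (hx : x ≠ 0) :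
    HasDerivAt (fun y : ℝ => c / y) (-c / x ^ 2) x := by
  have h : HasDerivAt (fun y : ℝ => c * y⁻¹) (c * (-(x ^ 2)⁻¹)) x := (hasDerivAt_inv hx).const_mul c
  have e1 : (fun y : ℝ => c / y) = fun y => c * y⁻¹ := funext fun y => div_eq_mul_inv c y
  have e2 : -c / x ^ 2 = c * (-(x ^ 2)⁻¹) := by rw [div_eq_mul_inv]; ring
  rw [e1, e2]; exact h

/-- `ℓ′(x) = −(c/x²)L′(c/x)` on `x > 0`. [cite: ConreyIwaniec2002, §6 (6.3), (6.27)] -/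
theorem hasDerivAt_ell {x : ℝ} (hx : 0 < x) :
    HasDerivAt (fun y : ℝ => ((ciL K (c / y) : ℝ) : ℂ))
      ((-c / x ^ 2 : ℝ) • ((iteratedDeriv 1 (ciL K) (c / x) : ℝ) : ℂ)) x := by
  have h1 : HasDerivAt (fun y : ℝ => ((iteratedDeriv 0 (ciL K) y : ℝ) : ℂ))
      ((iteratedDeriv (0 + 1) (ciL K) (c / x) : ℝ) : ℂ) (c / x) :=
    KernelMellin.hasDerivAt_iteratedDeriv_ciL hK (by norm_num) (c / x)
  simp only [iteratedDeriv_zero, zero_add] at h1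
  have h := h1.scomp x (hasDerivAt_const_div hx.ne')
  exact h

/-- `ℓ′` near `x > 0`. [cite: ConreyIwaniec2002, §6 (6.3), (6.27)] -/
theorem deriv_ell_eventually {x : ℝ} (hx : 0 < x) :
    deriv (fun y : ℝ => ((ciL K (c / y) : ℝ) : ℂ)) =ᶠ[𝓝 x]
      fun y => ((-c / y ^ 2 : ℝ) : ℂ) * ((iteratedDeriv 1 (ciL K) (c / y) : ℝ) : ℂ) := by
  filter_upwards [Ioi_mem_nhds hx] with y hy
  rw [(hasDerivAt_ell hK hy).deriv, Complex.real_smul]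

/-- `ℓ″(x) = (2c/x³)L′(c/x) + (c/x²)²L″(c/x)` on `x > 0`. [cite: ConreyIwaniec2002, §6 (6.3), (6.27)] -/
theorem hasDerivAt_deriv_ell {x : ℝ} (hx : 0 < x) :
    HasDerivAt (deriv (fun y : ℝ => ((ciL K (c / y) : ℝ) : ℂ)))
      (((2 * c / x ^ 3 : ℝ) : ℂ) * ((iteratedDeriv 1 (ciL K) (c / x) : ℝ) : ℂ) +
        ((-c / x ^ 2 : ℝ) : ℂ) *
          ((-c / x ^ 2 : ℝ) • ((iteratedDeriv 2 (ciL K) (c / x) : ℝ) : ℂ))) x := by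
  have hu : HasDerivAt (fun y : ℝ => ((-c / y ^ 2 : ℝ) : ℂ)) (((2 * c / x ^ 3 : ℝ)) : ℂ) x := by
    have hx' : x ≠ 0 := hx.ne'
    have h0 : HasDerivAt (fun y : ℝ => -c * (y ^ 2)⁻¹)
        (-c * (-((2 : ℕ) * x ^ (2 - 1)) / (x ^ 2) ^ 2)) x :=
      ((hasDerivAt_pow 2 x).inv (pow_ne_zero 2 hx')).const_mul (-c)
    have e1 : (fun y : ℝ => -c / y ^ 2) = fun y => -c * (y ^ 2)⁻¹ :=
      funext fun y => div_eq_mul_inv _ _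
    have e2 : 2 * c / x ^ 3 = -c * (-((2 : ℕ) * x ^ (2 - 1)) / (x ^ 2) ^ 2) := by
      rw [Nat.cast_ofNat, show (2:ℕ) - 1 = 1 from rfl, pow_one]
      field_simp
    have h1 : HasDerivAt (fun y : ℝ => -c / y ^ 2) (2 * c / x ^ 3) x := by
      rw [e1, e2]; exact h0
    exact h1.ofReal_comp
  have hw : HasDerivAt (fun y : ℝ => ((iteratedDeriv 1 (ciL K) (c / y) : ℝ) : ℂ))
      ((-c / x ^ 2 : ℝ) • ((iteratedDeriv 2 (ciL K) (c / x) : ℝ) : ℂ)) x := by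
    have h1 : HasDerivAt (fun y : ℝ => ((iteratedDeriv 1 (ciL K) y : ℝ) : ℂ))
        ((iteratedDeriv (1 + 1) (ciL K) (c / x) : ℝ) : ℂ) (c / x) :=
      KernelMellin.hasDerivAt_iteratedDeriv_ciL hK (by norm_num) (c / x)
    have h := h1.scomp x (hasDerivAt_const_div hx.ne')
    exact h
  exact (hu.mul hw).congr_of_eventuallyEq (deriv_ell_eventually hK hx)

/-- **The factor `ℓ(x) = L(c/x)`: `C²` on `(0,∞)` with `|ℓ| ≤ 1`, `x|ℓ′| ≤ 1`, `x²|ℓ″| ≤ 3`**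
(`v|L′(v)| ≤ v(1+v)⁻⁴ ≤ 1`, `2v|L′| + v²|L″| ≤ 3`, `v = c/x`). [cite: ConreyIwaniec2002, §6 (6.3), (6.27)] -/
theorem ell_bounds (hc : 0 < c) :
    ContDiffOn ℝ 2 (fun y : ℝ => ((ciL K (c / y) : ℝ) : ℂ)) (Ioi 0) ∧
      ∀ x : ℝ, 0 < x →
        ‖((ciL K (c / x) : ℝ) : ℂ)‖ ≤ 3 ∧
          x * ‖iteratedDeriv 1 (fun y : ℝ => ((ciL K (c / y) : ℝ) : ℂ)) x‖ ≤ 3 ∧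
          x ^ 2 * ‖iteratedDeriv 2 (fun y : ℝ => ((ciL K (c / y) : ℝ) : ℂ)) x‖ ≤ 3 := by
  have hL5 : ContDiff ℝ 5 (ciL K) := hK.2.2.2.2.1
  have hbd : ∀ j : ℕ, j ≤ 5 → ∀ v : ℝ, 0 < v → |iteratedDeriv j (ciL K) v| ≤ ((1 + v) ^ 4)⁻¹ := by
    intro j hj v hv
    have h := hK.2.2.2.2.2 j hj v
    rwa [abs_of_pos hv] at h
  refine ⟨?_, fun x hx => ⟨?_, ?_, ?_⟩⟩
  · have h1 : ContDiffOn ℝ 2 (fun y : ℝ => c / y) (Ioi 0) :=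
      contDiffOn_const.div contDiffOn_id fun y hy => ne_of_gt hy
    have h2 : ContDiff ℝ 2 (fun v : ℝ => ((ciL K v : ℝ) : ℂ)) :=
      Complex.ofRealCLM.contDiff.comp (hL5.of_le (by norm_num))
    exact h2.comp_contDiffOn h1
  · rw [Complex.norm_real, Real.norm_eq_abs]
    exact (Thm61OffDiagSeries.abs_ciL_le_one hK _).trans (by norm_num)
  · set v : ℝ := c / x with hv
    have hv0 : 0 < v := div_pos hc hx
    rw [iteratedDeriv_one, (hasDerivAt_ell hK hx).deriv, Complex.real_smul, norm_mul,
      Complex.norm_real, Complex.norm_real, Real.norm_eq_abs, Real.norm_eq_abs]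
    have e : x * |-c / x ^ 2| = v := by
      rw [abs_div, abs_neg, abs_of_pos hc, abs_of_pos (pow_pos hx 2), hv]
      field_simp
    have hL := hbd 1 (by norm_num) v hv0
    have h14 : v ≤ (1 + v) ^ 4 :=
      calc v ≤ (1 + v) ^ 1 := by rw [pow_one]; linarith
        _ ≤ (1 + v) ^ 4 := pow_le_pow_right₀ (by linarith) (by norm_num)
    calc x * (|-c / x ^ 2| * |iteratedDeriv 1 (ciL K) v|)
        = v * |iteratedDeriv 1 (ciL K) v| := by rw [← mul_assoc, e]
      _ ≤ v * ((1 + v) ^ 4)⁻¹ := mul_le_mul_of_nonneg_left hL hv0.le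
      _ ≤ 1 := by rw [mul_inv_le_iff₀ (by positivity), one_mul]; exact h14
      _ ≤ 3 := by norm_num
  · set v : ℝ := c / x with hv
    have hv0 : 0 < v := div_pos hc hx
    rw [iteratedDeriv_succ, iteratedDeriv_one, (hasDerivAt_deriv_ell hK hx).deriv,
      Complex.real_smul]
    have hL1 := hbd 1 (by norm_num) v hv0
    have hL2 := hbd 2 (by norm_num) v hv0
    have hq : 0 < ((1 + v) ^ 4)⁻¹ := by positivity
    have e1 : x ^ 2 * (2 * c / x ^ 3) = 2 * v := by rw [hv]; field_simp
    have e2 : x ^ 2 * (c / x ^ 2 * (c / x ^ 2)) = v ^ 2 := by rw [hv]; field_simp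
    have hn1 : ‖((2 * c / x ^ 3 : ℝ) : ℂ) * ((iteratedDeriv 1 (ciL K) v : ℝ) : ℂ)‖ ≤
        2 * c / x ^ 3 * ((1 + v) ^ 4)⁻¹ := by
      rw [norm_mul, Complex.norm_real, Complex.norm_real, Real.norm_of_nonneg (by positivity),
        Real.norm_eq_abs]
      exact mul_le_mul_of_nonneg_left hL1 (by positivity)
    have hn2 : ‖((-c / x ^ 2 : ℝ) : ℂ) * (((-c / x ^ 2 : ℝ) : ℂ) *
        ((iteratedDeriv 2 (ciL K) v : ℝ) : ℂ))‖ ≤ c / x ^ 2 * (c / x ^ 2) * ((1 + v) ^ 4)⁻¹ := by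
      rw [norm_mul, norm_mul, Complex.norm_real, Complex.norm_real, Real.norm_eq_abs,
        Real.norm_eq_abs, abs_div, abs_neg, abs_of_pos hc, abs_of_pos (pow_pos hx 2), ← mul_assoc]
      exact mul_le_mul_of_nonneg_left hL2 (by positivity)
    have h14 : 2 * v + v ^ 2 ≤ 3 * (1 + v) ^ 4 := by
      have h2 : (1 + v) ^ 2 ≤ (1 + v) ^ 4 := pow_le_pow_right₀ (by linarith) (by norm_num)
      have h3 : (1 + v) ^ 2 = 1 + 2 * v + v ^ 2 := by ring
      rw [h3] at h2
      nlinarith [sq_nonneg v, hv0.le]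
    calc x ^ 2 * ‖((2 * c / x ^ 3 : ℝ) : ℂ) * ((iteratedDeriv 1 (ciL K) v : ℝ) : ℂ) +
          ((-c / x ^ 2 : ℝ) : ℂ) * (((-c / x ^ 2 : ℝ) : ℂ) * ((iteratedDeriv 2 (ciL K) v : ℝ) : ℂ))‖
        ≤ x ^ 2 * (2 * c / x ^ 3 * ((1 + v) ^ 4)⁻¹ + c / x ^ 2 * (c / x ^ 2) * ((1 + v) ^ 4)⁻¹) :=
          mul_le_mul_of_nonneg_left ((norm_add_le _ _).trans (add_le_add hn1 hn2)) (by positivity)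
      _ = (2 * v + v ^ 2) * ((1 + v) ^ 4)⁻¹ := by rw [mul_add, ← mul_assoc, e1, ← mul_assoc, e2]; ring
      _ ≤ 3 := by rw [mul_inv_le_iff₀ (by positivity)]; exact h14

end Ell

/-! ### The generic constituent -/

/-- **A constituent `φ·b/(4PW)` is an admissible test function on `[X, 2X]`**: `φ ∈ C²(ℝ)` real,
vanishing off `[X,2X]` (`X > 0`), `|x|^m|φ^{(m)}(x)| ≤ P` (`m ≤ 2`); `b ∈ C²(0,∞)` with
`‖b‖, x‖b′‖, x²‖b″‖ ≤ W` on `[X, 2X]`. [cite: ConreyIwaniec2002, §6 (6.18), (6.27); §4 (4.23)] -/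
theorem isBumpOn_of_bounds {X P W : ℝ} (hX : 0 < X) (hP : 0 < P) (hW : 0 < W)
    {φ : ℝ → ℝ} (hφ : ContDiff ℝ 2 φ) (hφs : ∀ x, x ∉ Icc X (2 * X) → φ x = 0)
    (hφb : ∀ m : ℕ, m ≤ 2 → ∀ x : ℝ, |x| ^ m * |iteratedDeriv m φ x| ≤ P)
    {b : ℝ → ℂ} (hb : ContDiffOn ℝ 2 b (Ioi 0))
    (hbb : ∀ x ∈ Icc X (2 * X), ‖b x‖ ≤ W ∧ x * ‖iteratedDeriv 1 b x‖ ≤ W ∧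
      x ^ 2 * ‖iteratedDeriv 2 b x‖ ≤ W) :
    IsBumpOn X (fun x => (φ x : ℂ) * b x / ((4 * P * W : ℝ) : ℂ)) := by
  set M : ℝ := 4 * P * W with hM
  have hM0 : 0 < M := by positivity
  have hzero : ∀ x, x ∉ Icc X (2 * X) →
      (fun x => (φ x : ℂ) * b x / (M : ℂ)) =ᶠ[𝓝 x] fun _ => (0:ℂ) := by
    intro x hx
    filter_upwards [isClosed_Icc.isOpen_compl.mem_nhds hx] with y hy
    simp [hφs y hy]
  have hφC : ContDiff ℝ 2 (fun y => (φ y : ℂ)) := Complex.ofRealCLM.contDiff.comp hφ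
  have hcd : ContDiff ℝ 2 (fun x => (φ x : ℂ) * b x / (M : ℂ)) := by
    refine contDiff_iff_contDiffAt.2 fun x => ?_
    by_cases hx : x ∈ Icc X (2 * X)
    · have hx0 : 0 < x := lt_of_lt_of_le hX hx.1
      exact (hφC.contDiffAt.mul (hb.contDiffAt (Ioi_mem_nhds hx0))).div_const _
    · exact contDiffAt_const.congr_of_eventuallyEq (hzero x hx)
  refine ⟨hcd, fun x hx => by simp [hφs x hx], fun ν hν x => ?_⟩
  by_cases hx : x ∈ Icc X (2 * X)
  · have hx0 : 0 < x := lt_of_lt_of_le hX hx.1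
    obtain ⟨hb0, hb1, hb2⟩ := hbb x hx
    have hf0 : ‖(φ x : ℂ)‖ ≤ P := by
      have h := hφb 0 (by norm_num) x
      rw [pow_zero, one_mul, iteratedDeriv_zero] at h
      rwa [Complex.norm_real, Real.norm_eq_abs]
    have hf1 : x * ‖iteratedDeriv 1 (fun y => (φ y : ℂ)) x‖ ≤ P := by
      have h := hφb 1 (by norm_num) x
      rw [pow_one, abs_of_pos hx0] at h
      rwa [norm_iteratedDeriv_ofReal hφ (by norm_num)]
    have hf2 : x ^ 2 * ‖iteratedDeriv 2 (fun y => (φ y : ℂ)) x‖ ≤ P := by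
      have h := hφb 2 le_rfl x
      rw [sq_abs] at h
      rwa [norm_iteratedDeriv_ofReal hφ le_rfl]
    obtain ⟨h0, h1, h2⟩ := leibniz_Ioi hφC.contDiffOn hb hx0 hf0 hf1 hf2 hb0 hb1 hb2
    have hgi : ∀ i : ℕ, ‖iteratedDeriv i (fun y => (φ y : ℂ) * b y / (M : ℂ)) x‖ =
        ‖iteratedDeriv i (fun y => (φ y : ℂ) * b y) x‖ / M := by
      intro i
      rw [iteratedDeriv_div_const, norm_div, Complex.norm_real, Real.norm_of_nonneg hM0.le]
    rw [hgi]
    have hPW : 0 < P * W := mul_pos hP hW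
    interval_cases ν
    · rw [pow_zero, one_mul, iteratedDeriv_zero, div_le_one hM0, hM]
      linarith
    · rw [pow_one, ← mul_div_assoc, div_le_one hM0, hM]
      linarith
    · rw [← mul_div_assoc, div_le_one hM0, hM]
      linarith
  · have h0 : iteratedDeriv ν (fun y => (φ y : ℂ) * b y / (M : ℂ)) x = 0 := by
      rw [((hzero x hx).iteratedDeriv ν).eq_of_nhds, iteratedDeriv_const]
      simp
    rw [h0, norm_zero, mul_zero]
    exact zero_le_one

/-! ### (6.19) for un-normalised constituents -/

/-- **(6.19) scaled**: if `Φ₁/M₁`, `Φ₂/M₂` are admissible test functions on `[X, 2X]`, then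
`|Σ λ(n+h)λ̄(n)Φ₁(n+h)Φ₂(n) − σ(h)∫Φ₁(x+h)Φ₂(x)dx| ≤ M₁M₂·Bτ(h)X^{3/4}log²(3X)`.
[cite: ConreyIwaniec2002, §6 (6.19), (6.27)] -/
theorem shifted_bound_scaled {lam : ℕ → ℂ} {σ : ℕ → ℝ} {B₁ : ℝ}
    (hS : ShiftedConvolutionBound lam σ B₁) {X : ℝ} (hX : 1 / 2 ≤ X) {Φ₁ Φ₂ : ℝ → ℂ}
    {M₁ M₂ : ℝ} (hM₁ : 0 < M₁) (hM₂ : 0 < M₂)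
    (h₁ : IsBumpOn X (fun x => Φ₁ x / (M₁ : ℂ))) (h₂ : IsBumpOn X (fun x => Φ₂ x / (M₂ : ℂ)))
    {h : ℕ} (hh : 1 ≤ h) :
    ‖(∑ n ∈ Finset.Icc 1 ⌊2 * X⌋₊,
          lam (n + h) * starRingEnd ℂ (lam n) * Φ₁ ((n : ℝ) + h) * Φ₂ n) -
        (σ h : ℂ) * ∫ x : ℝ, Φ₁ (x + h) * Φ₂ x‖ ≤
      M₁ * M₂ * (B₁ * (Nat.divisors h).card * X ^ (3 / 4 : ℝ) * Real.log (3 * X) ^ 2) := by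
  have hb := hS X hX _ _ h₁ h₂ h hh
  have hM₁' : (M₁ : ℂ) ≠ 0 := by exact_mod_cast hM₁.ne'
  have hM₂' : (M₂ : ℂ) ≠ 0 := by exact_mod_cast hM₂.ne'
  have e : (∑ n ∈ Finset.Icc 1 ⌊2 * X⌋₊,
          lam (n + h) * starRingEnd ℂ (lam n) * Φ₁ ((n : ℝ) + h) * Φ₂ n) -
        (σ h : ℂ) * ∫ x : ℝ, Φ₁ (x + h) * Φ₂ x =
      ((M₁ : ℂ) * M₂) *
        ((∑ n ∈ Finset.Icc 1 ⌊2 * X⌋₊,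
            lam (n + h) * starRingEnd ℂ (lam n) * (Φ₁ ((n : ℝ) + h) / (M₁ : ℂ)) *
              (Φ₂ n / (M₂ : ℂ))) -
          (σ h : ℂ) * ∫ x : ℝ, Φ₁ (x + h) / (M₁ : ℂ) * (Φ₂ x / (M₂ : ℂ))) := by
    have hi : ∫ x : ℝ, Φ₁ (x + h) / (M₁ : ℂ) * (Φ₂ x / (M₂ : ℂ)) =
        (∫ x : ℝ, Φ₁ (x + h) * Φ₂ x) / ((M₁ : ℂ) * M₂) := by
      rw [← integral_div]
      congr 1; funext x
      field_simp
    rw [hi, mul_sub, Finset.mul_sum]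
    congr 1
    · refine Finset.sum_congr rfl fun n _ => ?_
      field_simp
    · field_simp
  rw [e, norm_mul, norm_mul, Complex.norm_real, Complex.norm_real, Real.norm_of_nonneg hM₁.le,
    Real.norm_of_nonneg hM₂.le]
  exact mul_le_mul_of_nonneg_left hb (mul_nonneg hM₁.le hM₂.le)

end Thm61Bumps

end ConreyIwaniec2002

end Literature.NumberTheory.LFunctions

end
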